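import Summits.CriticalPhenomena.CardyFormulaZ2.Theorems.CardyFlipRussoQuadrupoleSelectionRuleDefs
import Summits.CriticalPhenomena.CardyFormulaZ2.Theorems.CardyFlipRussoQuadrupoleSelectionRuleAnnealedRusso
import Summits.CriticalPhenomena.CardyFormulaZ2.Theorems.CardyFlipRussoQuadrupoleSelectionRuleFlipLocality
import Summits.CriticalPhenomena.CardyFormulaZ2.Theorems.CardyFlipRussoTargetStubGsDictionary
import Summits.CriticalPhenomena.CardyFormulaZ2.Theorems.CardyFlipRussoSquareFromVoronoiHubDecimationDefs
import HarnessLib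

/-!
# The endpoint `t = 1` of the bits leg is the route's target object

Helper file for the crux `QuadrupoleSelectionRule` (stmt-CriticalPhenomena-7029, informal) of route
`CardyFlipRusso` (sub-problem `CardyFormulaZ2`), line `Sketch` (generation 4), stubs W1a
(`Gamma_univ_eq_Gs`) and W1b (`legProb_one_eq_siteCrossingProb`).

* W1a: the leg graph with every bit on, `Gamma univ` (the rotated grid `Λ` plus the
  `ℤ²`-diagonal of every face), IS the centred square lattice `Gs` of `SquareFromVoronoiHub` /
  `Target (ii)` (`ℤ²` edges of length `1`, centre-to-corner edges of length `√2/2 < 1`).  The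
  route's positions `zGs` are the tree's `centredSquareEmbedding`
  (`CentreDecimation.zGs_eq_centredSquareEmbedding`), so the two distance computations are the
  landed `CardyFlipRussoTarget.dist_inl_inl_eq_one_iff` (two `ℤ²` points are at distance `1`
  iff they are lattice neighbours, i.e. iff they span the `ℤ²`-diagonal of a face) and `CardyFlipRussoTarget.dist_inl_inr_lt_one_iff` (a `ℤ²` point `x`
  and a dual point `f + (½,½)` are at distance `< 1` iff `x` is a corner of the face of `f`,
  which is `lamRel`).
* W1b: at `t = 1` the law of the bits is the Dirac mass at "all bits on" as far as the finitely
  many bits of the box `faces R δ` are concerned (cylinder expansion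
  `AnnealedRusso.integral_prodBernoulli_eq_sum_powerset`: only the term `S = faces R δ` survives),
  and the graph `Gamma ↑(faces R δ)` has the same edges as `Gamma univ = Gs` inside the window
  `{y | δ · zGs y ∈ Ω}` (a face one of whose diagonals has an endpoint in the window lies in the
  box, `mem_faces_of_inl_mem` / `mem_faces_of_inr_mem`), so by locality of connection events
  (`siteConnIn_congr`) the crude crossing events agree: `legProb R 1 δ = siteCrossingProb R δ`.
-/

noncomputable section

open MeasureTheory Set
open scoped BigOperators

namespace Summit.CriticalPhenomena.CardyFormulaZ2.Theorems.BitsLeg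

open Literature.Probability.LatticeModels Literature.Probability.Percolation
  Literature.Probability.RandomPlanarGeometry
open Summit.CriticalPhenomena.CardyFormulaZ2.Cruxes.SquareFromVoronoiHub.VoronoiBlocks
  (zGs Gs crudeCrossing siteCrossingProb)
open Summit.CriticalPhenomena.CardyFormulaZ2.Cruxes.SquareFromVoronoiHub.CentreDecimation
  (zGs_eq_centredSquareEmbedding)

/-! ### The rotated grid and the diagonals as edges of `G_s` -/

/-- `lamRel (inl x) (inr f)` says that `x` is a corner of the face centred at `f + (½,½)`.
[folklore] -/
theorem lamRel_inl_inr_iff (x f : ℤ × ℤ) :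
    lamRel (Sum.inl x) (Sum.inr f) ↔ (x.1 = f.1 ∨ x.1 = f.1 + 1) ∧ (x.2 = f.2 ∨ x.2 = f.2 + 1) := by
  simp only [lamRel]
  omega

/-- The `ℤ²`-diagonals of the faces are exactly the pairs of lattice neighbours. [folklore] -/
theorem exists_eq_BD_iff (x y : ℤ × ℤ) :
    (∃ k : Face, s((Sum.inl x : V), Sum.inl y) = s(fB k, fD k)) ↔
      (y.1 = x.1 + 1 ∧ y.2 = x.2) ∨ (x.1 = y.1 + 1 ∧ y.2 = x.2) ∨
        (y.2 = x.2 + 1 ∧ y.1 = x.1) ∨ (x.2 = y.2 + 1 ∧ y.1 = x.1) := by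
  obtain ⟨x1, x2⟩ := x
  obtain ⟨y1, y2⟩ := y
  constructor
  · rintro ⟨⟨⟨p, q⟩, e⟩, h⟩
    rcases Sym2.eq_iff.1 h with ⟨h1, h2⟩ | ⟨h1, h2⟩ <;> cases e <;>
      simp only [fB, fD, Bool.false_eq_true, if_false, if_true, Sum.inl.injEq,
        Prod.mk.injEq] at h1 h2 <;> omega
  · rintro (⟨h1, h2⟩ | ⟨h1, h2⟩ | ⟨h1, h2⟩ | ⟨h1, h2⟩)
    · refine ⟨((x1, x2), false), ?_⟩
      have hy : (y1, y2) = (x1 + 1, x2) := by simp only [Prod.mk.injEq]; omega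
      rw [hy]
      simp [fB, fD]
    · refine ⟨((y1, y2), false), ?_⟩
      have hx : (x1, x2) = (y1 + 1, y2) := by simp only [Prod.mk.injEq]; omega
      rw [hx, Sym2.eq_swap]
      simp [fB, fD]
    · refine ⟨((x1, x2), true), ?_⟩
      have hy : (y1, y2) = (x1, x2 + 1) := by simp only [Prod.mk.injEq]; omega
      rw [hy]
      simp [fB, fD]
    · refine ⟨((y1, y2), true), ?_⟩
      have hx : (x1, x2) = (y1, y2 + 1) := by simp only [Prod.mk.injEq]; omega
      rw [hx, Sym2.eq_swap]
      simp [fB, fD]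

/-- A `ℤ²`-diagonal has no dual endpoint. [folklore] -/
theorem inr_BD_ne (f : ℤ × ℤ) (v : V) (k : Face) : s((Sum.inr f : V), v) ≠ s(fB k, fD k) := by
  intro h
  rcases Sym2.eq_iff.1 h with ⟨h1, -⟩ | ⟨h1, -⟩ <;> simp [fB, fD] at h1

/-- `lamRel` never starts at a dual point. [folklore] -/
theorem not_lamRel_inr (f : ℤ × ℤ) (v : V) : ¬ lamRel (Sum.inr f) v := by
  cases v <;> simp [lamRel]

/-- **W1a.** The leg graph with every bit on is the centred square lattice `G_s` of the route's
`Target (ii)`: `Γ univ = G_s`. [folklore] -/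
theorem Gamma_univ_eq_Gs :
    Summit.CriticalPhenomena.CardyFormulaZ2.Theorems.BitsLeg.Gamma Set.univ =
      Summit.CriticalPhenomena.CardyFormulaZ2.Cruxes.SquareFromVoronoiHub.VoronoiBlocks.Gs := by
  ext u v
  rw [gamma_adj, Gs, SimpleGraph.fromRel_adj]
  refine and_congr_right fun _ => ?_
  simp only [Set.mem_univ, true_and, not_true_eq_false, false_and, or_false]
  cases u with
  | inl x =>
    cases v with
    | inl y =>
      simp only [lamRel, false_or, Sum.isLeft_inl, Sum.isRight_inl, Bool.false_eq_true,
        false_and, or_false, true_and]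
      rw [dist_comm (zGs (Sum.inl y)), or_self, exists_eq_BD_iff, zGs_eq_centredSquareEmbedding,
        CardyFlipRussoTarget.dist_inl_inl_eq_one_iff]
    | inr f =>
      have h1 : ¬ ∃ k : Face, s((Sum.inl x : V), Sum.inr f) = s(fB k, fD k) := fun ⟨k, hk⟩ =>
        inr_BD_ne f (Sum.inl x) k (by rw [Sym2.eq_swap]; exact hk)
      simp only [not_lamRel_inr, h1, or_false, Sum.isLeft_inl, Sum.isLeft_inr, Sum.isRight_inr,
        Bool.false_eq_true, false_and, false_or, true_and]
      rw [lamRel_inl_inr_iff, zGs_eq_centredSquareEmbedding,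
        CardyFlipRussoTarget.dist_inl_inr_lt_one_iff]
  | inr f =>
    cases v with
    | inl x =>
      have h1 : ¬ ∃ k : Face, s((Sum.inr f : V), Sum.inl x) = s(fB k, fD k) := fun ⟨k, hk⟩ =>
        inr_BD_ne f (Sum.inl x) k hk
      simp only [not_lamRel_inr, h1, or_false, false_or, Sum.isLeft_inl, Sum.isLeft_inr,
        Sum.isRight_inr, Bool.false_eq_true, false_and, true_and]
      rw [lamRel_inl_inr_iff, zGs_eq_centredSquareEmbedding,
        CardyFlipRussoTarget.dist_inl_inr_lt_one_iff]
    | inr g =>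
      constructor
      · rintro (h | h | ⟨k, hk⟩)
        · exact (not_lamRel_inr f _ h).elim
        · exact (not_lamRel_inr g _ h).elim
        · exact (inr_BD_ne f _ k hk).elim
      · rintro (⟨h, -⟩ | ⟨h, -⟩) <;> simp at h

/-! ### Faces with a diagonal endpoint in the window lie in the box -/

/-- A vertex read in the window `{y | δ · zGs y ∈ Ω}` has `‖zGs y‖ + 2 ≤ boxN R δ`. [folklore] -/
theorem norm_zGs_add_two_le (R : ConformalRectangle) {δ : ℝ} (hδ : 0 < δ) {v : V}
    (hv : (δ : ℂ) * zGs v ∈ R.carrier) : ‖zGs v‖ + 2 ≤ (boxN R δ : ℝ) := by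
  have hρ := Classical.choose_spec (exists_norm_le R) _ hv
  rw [norm_mul, Complex.norm_real, Real.norm_of_nonneg hδ.le] at hρ
  have h1 : ‖zGs v‖ ≤ Classical.choose (exists_norm_le R) / δ := by
    rw [le_div_iff₀ hδ, mul_comm]; exact hρ
  have h2 := Nat.le_ceil (Classical.choose (exists_norm_le R) / δ)
  simp only [boxN, Nat.cast_add, Nat.cast_ofNat]
  linarith

/-- A face whose pivot has both coordinates of absolute value `≤ boxN R δ` is read. [folklore] -/
theorem mem_faces_of_abs_le (R : ConformalRectangle) (δ : ℝ) {k : Face}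
    (h1 : |(k.1.1 : ℝ)| ≤ boxN R δ) (h2 : |(k.1.2 : ℝ)| ≤ boxN R δ) : k ∈ faces R δ := by
  rw [abs_le] at h1 h2
  simp only [faces, box, Finset.mem_product, Finset.mem_Icc, Finset.mem_univ, and_true]
  exact ⟨⟨by exact_mod_cast h1.1, by exact_mod_cast h1.2⟩, by exact_mod_cast h2.1,
    by exact_mod_cast h2.2⟩

/-- A face whose `ℤ²` pivot `B k` is read in the window lies in the box of faces. [folklore] -/
theorem mem_faces_of_inl_mem (R : ConformalRectangle) {δ : ℝ} (hδ : 0 < δ) {k : Face}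
    (h : (δ : ℂ) * zGs (Sum.inl k.1) ∈ R.carrier) : k ∈ faces R δ := by
  have hb := norm_zGs_add_two_le R hδ h
  have hre := Complex.abs_re_le_norm (zGs (Sum.inl k.1))
  have him := Complex.abs_im_le_norm (zGs (Sum.inl k.1))
  have hre' : (zGs (Sum.inl k.1)).re = k.1.1 := by simp [zGs]
  have him' : (zGs (Sum.inl k.1)).im = k.1.2 := by simp [zGs]
  rw [hre'] at hre
  rw [him'] at him
  exact mem_faces_of_abs_le R δ (by linarith) (by linarith)

/-- A face whose dual corner `A k` is read in the window lies in the box of faces. [folklore] -/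
theorem mem_faces_of_inr_mem (R : ConformalRectangle) {δ : ℝ} (hδ : 0 < δ) {k : Face}
    (h : (δ : ℂ) * zGs (Sum.inr k.1) ∈ R.carrier) : k ∈ faces R δ := by
  have hb := norm_zGs_add_two_le R hδ h
  have hre := Complex.abs_re_le_norm (zGs (Sum.inr k.1))
  have him := Complex.abs_im_le_norm (zGs (Sum.inr k.1))
  have hre' : (zGs (Sum.inr k.1)).re = k.1.1 + 1 / 2 := by simp [zGs]
  have him' : (zGs (Sum.inr k.1)).im = k.1.2 + 1 / 2 := by simp [zGs]
  rw [hre', abs_le] at hre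
  rw [him', abs_le] at him
  exact mem_faces_of_abs_le R δ (abs_le.2 ⟨by linarith [hre.1], by linarith [hre.2]⟩)
    (abs_le.2 ⟨by linarith [him.1], by linarith [him.2]⟩)

/-- **Inside the window, freezing the bits outside the box changes no edge**: for `x, y` read in
`{y | δ · zGs y ∈ Ω}`, `Γ ↑(faces R δ)` and `Γ univ` agree on `{x, y}`. [folklore] -/
theorem gamma_faces_adj_iff (R : ConformalRectangle) {δ : ℝ} (hδ : 0 < δ) {x y : V}
    (hx : (δ : ℂ) * zGs x ∈ R.carrier) (hy : (δ : ℂ) * zGs y ∈ R.carrier) :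
    (Gamma ↑(faces R δ)).Adj x y ↔ (Gamma Set.univ).Adj x y := by
  rw [gamma_adj, gamma_adj]
  refine and_congr_right fun _ => or_congr_right (or_congr_right ?_)
  constructor
  · rintro ⟨k, ⟨-, h⟩ | ⟨hk, h⟩⟩
    · exact ⟨k, Or.inl ⟨Set.mem_univ _, h⟩⟩
    · refine absurd (Finset.mem_coe.2 (mem_faces_of_inr_mem R hδ ?_)) hk
      rcases Sym2.eq_iff.1 h with ⟨h1, -⟩ | ⟨-, h2⟩
      · rw [h1] at hx; exact hx
      · rw [h2] at hy; exact hy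
  · rintro ⟨k, ⟨-, h⟩ | ⟨hk, -⟩⟩
    · refine ⟨k, Or.inl ⟨Finset.mem_coe.2 (mem_faces_of_inl_mem R hδ ?_), h⟩⟩
      rcases Sym2.eq_iff.1 h with ⟨h1, -⟩ | ⟨-, h2⟩
      · rw [h1] at hx; exact hx
      · rw [h2] at hy; exact hy
    · exact absurd (Set.mem_univ k) hk

/-- The crude crossing event read in `Γ ↑(faces R δ)` is the route's `crudeCrossing` (read in
`G_s = Γ univ`): connection events in the window only read edges inside it. [folklore] -/
theorem crossingEvent_gamma_faces (R : ConformalRectangle) {δ : ℝ} (hδ : 0 < δ) :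
    crossingEvent R δ (Gamma ↑(faces R δ)) = crudeCrossing R δ := by
  have hconn : ∀ u v : V,
      siteConnIn (Gamma ↑(faces R δ)) {y : V | (δ : ℂ) * zGs y ∈ R.carrier} u v =
        siteConnIn Gs {y : V | (δ : ℂ) * zGs y ∈ R.carrier} u v := fun u v => by
    rw [← Gamma_univ_eq_Gs]
    exact siteConnIn_congr (fun x y hx hy => gamma_faces_adj_iff R hδ hx hy) u v
  ext ω
  simp only [crossingEvent, crudeCrossing, Set.mem_setOf_eq, hconn]

/-! ### The endpoint `t = 1` -/

/-- **W1b.** At `t = 1` the annealed crossing probability of the bits leg is the crude crossing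
probability of site percolation at `1/2` on `G_s`: `legProb R 1 δ = siteCrossingProb R δ`.
[folklore] -/
theorem legProb_one_eq_siteCrossingProb :
    ∀ (R : Literature.Probability.RandomPlanarGeometry.ConformalRectangle) (δ : ℝ), 0 < δ →
      Summit.CriticalPhenomena.CardyFormulaZ2.Theorems.BitsLeg.legProb R 1 δ =
        Summit.CriticalPhenomena.CardyFormulaZ2.Cruxes.SquareFromVoronoiHub.VoronoiBlocks.siteCrossingProb
          R δ := by
  intro R δ hδ
  classical
  have hg : ∀ τ : Set Face,
      (sitePercolation V half).real (crossingEvent R δ (GammaMesh R δ τ)) =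
        (sitePercolation V half).real (crossingEvent R δ (GammaMesh R δ (τ ∩ ↑(faces R δ)))) :=
    fun τ => by rw [← gammaMesh_inter R δ τ]
  rw [legProb, legLaw, AnnealedRusso.integral_prodBernoulli_eq_sum_powerset (faces R δ)
    (fun τ => (sitePercolation V half).real (crossingEvent R δ (GammaMesh R δ τ))) hg,
    Finset.sum_eq_single_of_mem (faces R δ) (Finset.mem_powerset_self _)]
  · have h1 : ∏ i ∈ faces R δ, (if i ∈ faces R δ then
        ((Set.projIcc (0 : ℝ) 1 zero_le_one 1 : unitInterval) : ℝ) else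
        1 - ((Set.projIcc (0 : ℝ) 1 zero_le_one 1 : unitInterval) : ℝ)) = 1 :=
      Finset.prod_eq_one fun i hi => by simp [hi, Set.projIcc_right]
    rw [h1, mul_one, siteCrossingProb, GammaMesh, Set.inter_self, crossingEvent_gamma_faces R hδ]
  · intro S hS hne
    obtain ⟨i, hiK, hiS⟩ := Finset.exists_of_ssubset
      (Finset.ssubset_iff_subset_ne.2 ⟨Finset.mem_powerset.1 hS, hne⟩)
    rw [Finset.prod_eq_zero hiK (by simp [hiS, Set.projIcc_right]), mul_zero]

end Summit.CriticalPhenomena.CardyFormulaZ2.Theorems.BitsLeg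

end
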